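import Summits.Ventures.CertifiedManyBodySolver.Observables.PairLROTowerWitnessAt
import Summits.Ventures.CertifiedManyBodySolver.Observables.RungLeavesPairAnchor
import Literature.MathematicalPhysics.QuantumLattice.TorusLimitAsymptoticGroundStateFamilies
import Literature.MathematicalPhysics.QuantumLattice.InfVolFermionStateCompactness
import HarnessLib

/-!
# The Koma–Tasaki tower witnesses have GROUND-STATE torus limits: the one-point objects may use every
# ground-state row (stationarity, charged / Nambu KKT blocks at the supporting `μ`), and a one-point bound
# over translation-invariant ground states of `H^{tt'} − μN` of density `n` is the ceiling `liminf u_k ≤ M²`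

HONEST FRAMING: soundness ("licence") theorems for a CEILING route at positivity scale; a ceiling never
speaks to the presence of pairing; not a superconductivity verdict; nothing in this file is a number. Crew
hubbard-obs (D-0042), seat hubbard-obs-gs-2 (`prover-hubbard-obs-gs-2-g3-0`, row «ε-elasticity / ground-state
rows», EPS-ELASTICITY-gs2.md §K.4 licence (L1)). Zero compute; no definition; no named fact; no `sorry`.

The cell's one-point pair-amplitude certificates (registry rows `OBS.PhiD1pt.*`, tiers OP1-E/S/C) are read
through low-energy WITNESS vectors of the finite tori built from a sector ground state `ψ_L` with pair LRO:
the Koma–Tasaki charge tower `(Δ_g†)^m ψ_L/‖·‖`, `m ≤ k` (`exists_towerWitness`, PairLROTowerCeiling: one-point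
amplitude `≥ (k/(k+1))ρ_L`, `ρ_L² = c₀L⁴ − (k+1)C_γL²`, energy excess `O_k(1)`, spin fillings `N_L/2 + k/2`).
So far the rows licensed on these objects were: translation invariance (orbit averaging), fillings, the energy
cap (tier E), neutral stationarity (Pusz–Woronowicz slack, tier S) and charged stationarity on a certified
`μ`-bracket (grand-canonical floor, tier C); ground-state POSITIVITY (`kkt`) blocks were unlicensed because a
witness is not an eigenvector. This file closes the question once and for all by passing to the limit STATE:

(The one-torus witness with its numerics exposed is `exists_towerWitnessAt`, file `PairLROTowerWitnessAt.lean`.)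
* **`exists_torusLimit_towerWitness_groundState`** — for unit `(rectN n L, S^z = 0)`-sector ground states
  `ψ_L` of `hubbardTorusTT' L t t' U` (`U ≥ 0`, `0 < n < 2`) with `c₀L_j⁴ ≤ Re⟨ψ, Δ_g†Δ_g ψ⟩` eventually along
  `L_j → ∞`, and every tower height `k`: there are a witness family `Ξ`, a subsequence `φ`, a state `ω` and a
  chemical potential `μ ∈ [μ₋(n), μ₊(n)]` such that `ω` is the torus limit of `Ξ` along `L_{φ(j)}`, `ω` is
  translation invariant of density `n` and mean energy `e(t,t',U,n)`, `ω` is a mean-energy MINIMISER and a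
  Bratteli–Robinson GROUND STATE of `hubbardTTPrimeMuInteraction t t' U μ` — hence (`IsGroundState.re_expect_kktForm_nonneg`,
  `IsTorusLimitOf.groundStateRows_of_asymptoticGroundStates`) obeys EVERY ground-state row: stationarity and
  PSD-weighted KKT blocks of `H^{tt'μ}_{Λ₁}` over arbitrary (charged, Nambu, spin-flip) local generators — and
  its one-point amplitude is LARGE: `(k/(k+1))·√c₀ ≤ Re ω(Φ₀^g)`, `Φ₀^g = localPairAt {0,±e₁,±e₂} g 0`
  (Literature `IsTorusLimitOf.canonicalMinimiser_of_asymptoticGroundStates`: number density `→ n` and energy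
  per site asymptotically `≤ e(n)` is all a torus limit needs to be a fixed-density minimiser; Ruelle's
  multiplier and Bratteli–Kishimoto–Robinson Thm. 2 do the rest).
* **`liminf_pairFieldLRO_le_sq_of_groundState_onePoint_bound`** — THE GROUND-STATE-COMPLETE ONE-POINT
  READING: if `Re ω(Φ₀^g) ≤ M` for every `μ ∈ [μ₋(n), μ₊(n)]` (`chemPotMinusTT'`/`chemPotPlusTT'`, the
  subdifferential of `e(t,t',U,·)`; covered by any certified bracket) and every translation-invariant `ω` of
  density `n` that is a
  minimiser and a ground state of `H^{tt'} − μN`, then every family of unit sector ground states has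
  `liminf_k u_k ≤ M²` (sharp Koma–Tasaki constant). A certificate may therefore use ANY row valid in such
  states — the whole ground-state row class, with ONE common chemical potential `μ` (to be covered by a
  certified bracket, as in the OP1-C program) — and still be read as a pair-LRO ceiling of the summit's
  sequence. The registry-format corollary `ObsPairLROCeilingAt_of_groundState_onePoint_bound`.

WHAT THIS IS NOT: no new number; the KKT/Nambu rows so licensed were measured INERT (×1.000) on every
one-point object the cell owns (EPS-ELASTICITY-gs2.md §K.3) — this is soundness bookkeeping for future,
larger footprints; `μ` is not computed here.

References: T. Koma, H. Tasaki, J. Stat. Phys. 76 (1994) 745–803, §2.2 and Theorem 5 [KomaTasaki1994];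
O. Bratteli, A. Kishimoto, D. W. Robinson, Commun. Math. Phys. 64 (1978) 41–48, Thm. 2
[BratteliKishimotoRobinson1978]; D. Ruelle, *Statistical Mechanics: Rigorous Results* (1969) §3.4 [Ruelle1969];
M. Araújo et al., arXiv:2311.18707, §3.2 Prop. 11 [AraujoEtAl2023].
-/

noncomputable section

namespace Summit.Ventures.CertifiedManyBodySolver.Observables

open Matrix Complex Finset Literature.MathematicalPhysics.QuantumLattice Literature.Probability.LatticeModels
open Literature.MathematicalPhysics.QuantumLattice.HubbardWave0 ThermodynamicLimit Filter Topology
open Literature.MathematicalPhysics.QuantumManyBody.StateRelaxation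
open scoped ComplexOrder ComplexConjugate BigOperators

/-! ### §1  Families: the torus limits of the tower witnesses are ground states of `H^{tt'} − μN` -/

section Family

variable (g : Site 2 → ℝ)

/-- **Koma–Tasaki's symmetry breaking from long-range order, infinite-volume translation-invariant form,
for the summit's families.** `U ≥ 0`, `0 < n < 2`, any `t, t'`, any form factor `g`, any tower height `k`.
Let `ψ_L` be unit ground states of `hubbardTorusTT' L t t' U` in the sectors `(rectN n L, S^z = 0)` with pair
LRO `c₀L_j⁴ ≤ Re⟨ψ, Δ_g†Δ_g ψ⟩` (`c₀ > 0`) eventually along sides `L_j → ∞`. Then there are a witness family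
`Ξ` (the height-`k` towers), a subsequence `φ`, a state `ω` and a chemical potential `μ` with: `ω` is the
torus limit of `Ξ` along `L ∘ φ`; `ω` is translation invariant of density `n` and mean energy `e(t,t',U,n)`;
`μ₋(n) ≤ μ ≤ μ₊(n)` (the subdifferential of `e(t,t',U,·)` at `n`); `ω` is a mean-energy minimiser AND a
Bratteli–Robinson ground state of `hubbardTTPrimeMuInteraction t t' U μ` (so every ground-state row holds in
`ω`); and `(k/(k+1))√c₀ ≤ Re ω(Φ₀^g)`.
[cite: KomaTasaki1994, §2.2 and Theorem 5] [cite: BratteliKishimotoRobinson1978, Thm. 2 (p. 47)] -/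
theorem exists_torusLimit_towerWitness_groundState (t t' : ℝ) {U n : ℝ} (hU : 0 ≤ U) (hn0 : 0 < n)
    (hn2 : n < 2) (ψ : ∀ L, Fock (Orb (FermionTorus 2 L)))
    (hψ : ∀ L, IsGroundStateInSector (hubbardTorusTT' L t t' U) (rectN n L) 0 (ψ L))
    (hψ1 : ∀ L, star (ψ L) ⬝ᵥ ψ L = 1) {Ls : ℕ → ℕ} [hLne : ∀ j, NeZero (Ls j)]
    (hLs : Tendsto Ls atTop atTop) {c₀ : ℝ} (hc₀ : 0 < c₀)
    (hlro : ∀ᶠ j in atTop, c₀ * (Ls j : ℝ) ^ 4 ≤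
      (expect ((pairField g (Ls j))ᴴ * pairField g (Ls j)) (ψ (Ls j))).re) (k : ℕ) :
    ∃ (Ξ : ∀ L, Fock (Orb (FermionTorus 2 L))) (φ : ℕ → ℕ) (ω : InfVolFermionState 2) (μ : ℝ),
      StrictMono φ ∧ ω.IsTorusLimitOf Ξ (Ls ∘ φ) ∧ ω.IsTranslationInvariant ∧ ω.density = n ∧
      ω.meanEnergy (hubbardTTPrimeFermionInteraction t t' U) 1 = energyDensityTT' t t' U n ∧
      μ ∈ Set.Icc (chemPotMinusTT' t t' U n) (chemPotPlusTT' t t' U n) ∧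
      ω.IsMeanEnergyMinimiser (hubbardTTPrimeMuInteraction t t' U μ) 1 ∧
      ω.IsGroundState (hubbardTTPrimeMuInteraction t t' U μ) 1 ∧
      (k : ℝ) / (k + 1) * Real.sqrt c₀ ≤
        (ω.expect (pairRegion (insert (0 : Site 2) unitSteps) 0)
          (localPairAt (insert (0 : Site 2) unitSteps) g 0)).re := by
  classical
  obtain ⟨Cγ, Lγ, hCγ, hγ⟩ := exists_abs_re_expect_commutator_pairField_le g
  obtain ⟨Cα, Lα, hCα, hα⟩ := exists_eucNorm_pairField_conjTranspose_mulVec_le g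
  obtain ⟨Cκ, Lκ, hCκ, hκ'⟩ := exists_eucNorm_commutator_hubbardTorusTT'_pairField_conjTranspose_mulVec_le g t t' U
  set Dbar : ℝ := (Cκ / Real.sqrt (c₀ / 2)) * ∑ i ∈ Finset.range k, (Cα / Real.sqrt (c₀ / 2)) ^ i with hDbar
  obtain ⟨L₂, hL₂⟩ : ∃ L₂ : ℕ, ∀ L : ℕ, L₂ ≤ L → ((k : ℝ) + 1) * Cγ ≤ (c₀ / 2) * (L : ℝ) ^ 2 := by
    obtain ⟨L₂, hL₂⟩ := exists_nat_ge (((k : ℝ) + 1) * Cγ / (c₀ / 2))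
    refine ⟨max L₂ 1, fun L hL => ?_⟩
    have hL1 : (1 : ℝ) ≤ L := by exact_mod_cast le_trans (le_max_right _ _) hL
    have hLL : (L₂ : ℝ) ≤ L := by exact_mod_cast le_trans (le_max_left _ _) hL
    have hc2 : 0 < c₀ / 2 := by linarith
    have h1 : ((k : ℝ) + 1) * Cγ ≤ (c₀ / 2) * L := by
      rw [div_le_iff₀ hc2] at hL₂; nlinarith
    have h2 : (c₀ / 2) * (L : ℝ) ≤ (c₀ / 2) * (L : ℝ) ^ 2 := by
      have : (L : ℝ) ≤ (L : ℝ) ^ 2 := by nlinarith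
      exact mul_le_mul_of_nonneg_left this hc2.le
    linarith
  -- the "good side" predicate and the witness family (the ground state itself off the good sides)
  let good : ℕ → Prop := fun L => Lγ ≤ L ∧ Lα ≤ L ∧ Lκ ≤ L ∧ L₂ ≤ L ∧ ∀ _hL : NeZero L,
    c₀ * (L : ℝ) ^ 4 ≤ (expect ((pairField g L)ᴴ * pairField g L) (ψ L)).re
  have hgoodW : ∀ (L : ℕ) [NeZero L], good L → ∃ Ξ : Fock (Orb (FermionTorus 2 L)), star Ξ ⬝ᵥ Ξ = 1 ∧
      (k : ℝ) / (k + 1) * ((L : ℝ) ^ 2 * Real.sqrt (c₀ - (k + 1) * Cγ / (L : ℝ) ^ 2)) ≤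
        (star Ξ ⬝ᵥ (pairField g L *ᵥ Ξ)).re ∧
      (star Ξ ⬝ᵥ (hubbardTorusTT' L t t' U *ᵥ Ξ)).re ≤
        (hubbardTorusTT' L t t' U).minEnergyOn (szSector (rectN n L) 0) + Dbar ∧
      ∀ σ : Fin 2, (star Ξ ⬝ᵥ ((∑ y : FermionTorus 2 L, numberOp y σ) *ᵥ Ξ)).re =
        (rectN n L : ℝ) / 2 + k / 2 := by
    intro L _ hL
    obtain ⟨h1, h2, h3, h4, h5⟩ := hL
    exact exists_towerWitnessAt g t t' U (hψ1 L) (hψ L) hc₀ hCα hCκ hCγ k (hα L h2) (hκ' L h3) (hγ L h1)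
      (h5 inferInstance) (hL₂ L h4)
  let Ξ : ∀ L, Fock (Orb (FermionTorus 2 L)) := fun L =>
    if h : (∃ _ : NeZero L, good L) then @Classical.choose _ _ (@hgoodW L h.1 h.2) else ψ L
  have hΞ1 : ∀ L, star (Ξ L) ⬝ᵥ Ξ L = 1 := by
    intro L
    by_cases h : (∃ _ : NeZero L, good L)
    · simp only [Ξ, dif_pos h]
      exact (@Classical.choose_spec _ _ (@hgoodW L h.1 h.2)).1
    · simp only [Ξ, dif_neg h]
      exact hψ1 L
  have hΞgood : ∀ (L : ℕ) [NeZero L], good L →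
      (k : ℝ) / (k + 1) * ((L : ℝ) ^ 2 * Real.sqrt (c₀ - (k + 1) * Cγ / (L : ℝ) ^ 2)) ≤
        (star (Ξ L) ⬝ᵥ (pairField g L *ᵥ Ξ L)).re ∧
      (star (Ξ L) ⬝ᵥ (hubbardTorusTT' L t t' U *ᵥ Ξ L)).re ≤
        (hubbardTorusTT' L t t' U).minEnergyOn (szSector (rectN n L) 0) + Dbar ∧
      ∀ σ : Fin 2, (star (Ξ L) ⬝ᵥ ((∑ y : FermionTorus 2 L, numberOp y σ) *ᵥ Ξ L)).re =
        (rectN n L : ℝ) / 2 + k / 2 := by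
    intro L hne hL
    have h : (∃ _ : NeZero L, good L) := ⟨hne, hL⟩
    have hspec := @Classical.choose_spec _ _ (@hgoodW L h.1 h.2)
    have hΞeq : Ξ L = @Classical.choose _ _ (@hgoodW L h.1 h.2) := by simp only [Ξ, dif_pos h]
    rw [hΞeq]
    exact ⟨hspec.2.1, hspec.2.2.1, hspec.2.2.2⟩
  -- eventually along `Ls`, the sides are good
  have hev_good : ∀ᶠ j in atTop, good (Ls j) := by
    filter_upwards [hlro, hLs.eventually_ge_atTop (max Lγ (max Lα (max Lκ L₂)))] with j hj hjL
    simp only [max_le_iff] at hjL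
    obtain ⟨h1, h2, h3, h4⟩ := hjL
    exact ⟨h1, h2, h3, h4, fun _ => hj⟩
  -- compactness: a torus limit of the witness family along a subsequence
  obtain ⟨φ, hφ, ω, hω⟩ := InfVolFermionState.exists_isTorusLimitOf_subseq Ξ hLs (fun j => hΞ1 (Ls j))
  have hLsφ : Tendsto (Ls ∘ φ) atTop atTop := hLs.comp hφ.tendsto_atTop
  have hev_goodφ : ∀ᶠ j in atTop, good (Ls (φ j)) := hφ.tendsto_atTop.eventually hev_good
  -- number density → n
  have hL2inv : Tendsto (fun j => (((Ls (φ j) : ℕ) : ℝ) ^ 2)⁻¹) atTop (𝓝 0) :=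
    ((tendsto_pow_atTop (α := ℝ) two_ne_zero).comp (tendsto_natCast_atTop_atTop.comp hLsφ)).inv_tendsto_atTop
  have hN : Tendsto (fun j => (∑ σ : Fin 2,
      (star (Ξ (Ls (φ j))) ⬝ᵥ ((∑ y : FermionTorus 2 (Ls (φ j)), numberOp y σ) *ᵥ Ξ (Ls (φ j)))).re) /
        ((Ls (φ j) : ℝ)) ^ 2) atTop (𝓝 n) := by
    have h1 : Tendsto (fun j => (rectN n (Ls (φ j)) : ℝ) / ((Ls (φ j) : ℕ) : ℝ) ^ 2 +
        (k : ℝ) * ((((Ls (φ j)) : ℕ) : ℝ) ^ 2)⁻¹) atTop (𝓝 (n + (k : ℝ) * 0)) :=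
      ((tendsto_rectN_div_sq hn0.le).comp hLsφ).add (hL2inv.const_mul _)
    rw [mul_zero, add_zero] at h1
    refine h1.congr' ?_
    filter_upwards [hev_goodφ, hLsφ.eventually_ge_atTop 1] with j hj hj1
    obtain ⟨-, -, hfill⟩ := hΞgood (Ls (φ j)) hj
    rw [Fin.sum_univ_two, hfill 0, hfill 1]
    have hLpos : (0 : ℝ) < ((Ls (φ j) : ℕ) : ℝ) := by
      have : (1 : ℝ) ≤ (Ls (φ j) : ℕ) := by exact_mod_cast hj1
      linarith
    field_simp
    ring
  -- energy per site asymptotically ≤ e(n)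
  have hE : ∀ ε : ℝ, 0 < ε → ∀ᶠ j in atTop,
      (star (Ξ (Ls (φ j))) ⬝ᵥ (hubbardTorusTT' (Ls (φ j)) t t' U *ᵥ Ξ (Ls (φ j)))).re /
          ((Ls (φ j) : ℝ)) ^ 2 ≤ energyDensityTT' t t' U n + ε := by
    intro ε hε
    have hElim : Tendsto (fun j => groundEnergy (hubbardTorusTT' (Ls (φ j)) t t' U) (rectN n (Ls (φ j))) /
        (((Ls (φ j) : ℕ) : ℝ)) ^ 2 + Dbar * ((((Ls (φ j)) : ℕ) : ℝ) ^ 2)⁻¹) atTop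
        (𝓝 (energyDensityTT' t t' U n + Dbar * 0)) :=
      ((tendsto_energyDensityTT'_torus t t' hU hn0.le hn2).comp hLsφ).add (hL2inv.const_mul _)
    rw [mul_zero, add_zero] at hElim
    have hev2 := (tendsto_order.1 hElim).2 _ (lt_add_of_pos_right _ hε)
    filter_upwards [hev_goodφ, hev2, hLsφ.eventually_ge_atTop 1] with j hj hj2 hj1
    obtain ⟨-, hen, -⟩ := hΞgood (Ls (φ j)) hj
    have hLpos : (0 : ℝ) < ((Ls (φ j) : ℕ) : ℝ) ^ 2 := by
      have : (1 : ℝ) ≤ (Ls (φ j) : ℕ) := by exact_mod_cast hj1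
      positivity
    have hcard : ⌊n * (((Ls (φ j) : ℕ)) : ℝ) ^ 2 / 2⌋₊ ≤ Fintype.card (FermionTorus 2 (Ls (φ j))) := by
      rw [show Fintype.card (FermionTorus 2 (Ls (φ j))) = (Ls (φ j)) ^ 2 by simp]
      have h2 := rectN_le_two_mul hn0.le hn2.le (Ls (φ j))
      simp only [rectN] at h2
      have e : (Ls (φ j)) ^ 2 = (Ls (φ j)) * (Ls (φ j)) := by ring
      rw [e]
      exact Nat.le_of_mul_le_mul_left h2 (by norm_num)
    have hEeq : (hubbardTorusTT' (Ls (φ j)) t t' U).minEnergyOn (szSector (rectN n (Ls (φ j))) 0) =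
        groundEnergy (hubbardTorusTT' (Ls (φ j)) t t' U) (rectN n (Ls (φ j))) := by
      simp only [rectN]
      rw [groundEnergy_hubbardTorusTT'_eq_minEnergyOn_szSector (Ls (φ j)) t t' U hcard]
    rw [hEeq] at hen
    have h3 : (star (Ξ (Ls (φ j))) ⬝ᵥ (hubbardTorusTT' (Ls (φ j)) t t' U *ᵥ Ξ (Ls (φ j)))).re /
        (((Ls (φ j) : ℕ) : ℝ)) ^ 2 ≤
        groundEnergy (hubbardTorusTT' (Ls (φ j)) t t' U) (rectN n (Ls (φ j))) / (((Ls (φ j) : ℕ) : ℝ)) ^ 2 +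
          Dbar * ((((Ls (φ j) : ℕ) : ℝ)) ^ 2)⁻¹ := by
      rw [← div_eq_mul_inv, ← add_div]
      exact div_le_div_of_nonneg_right hen hLpos.le
    exact h3.trans hj2.le
  -- Literature: the torus limit is a canonical minimiser, a minimiser and a ground state of the pencil
  obtain ⟨hTI, hρ, hme, -⟩ :=
    hω.canonicalMinimiser_of_asymptoticGroundStates t t' hU hn0 hn2 hLsφ hN hE
  obtain ⟨μ, hμ, hmin, hgs⟩ :=
    hω.exists_groundState_hubbardTTPrimeMu_mem_Icc_of_asymptoticGroundStates t t' hU hn0 hn2 hLsφ hN hE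
  -- the one-point amplitude survives in the limit
  have hamp : (k : ℝ) / (k + 1) * Real.sqrt c₀ ≤
      (ω.expect (pairRegion (insert (0 : Site 2) unitSteps) 0)
        (localPairAt (insert (0 : Site 2) unitSteps) g 0)).re := by
    have hlim := (Complex.continuous_re.tendsto _).comp
      (hω (pairRegion (insert (0 : Site 2) unitSteps) 0) (localPairAt (insert (0 : Site 2) unitSteps) g 0))
    have hlow : Tendsto (fun j => (k : ℝ) / (k + 1) *
        Real.sqrt (c₀ - (k + 1) * Cγ * ((((Ls (φ j)) : ℕ) : ℝ) ^ 2)⁻¹)) atTop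
        (𝓝 ((k : ℝ) / (k + 1) * Real.sqrt (c₀ - (k + 1) * Cγ * 0))) :=
      ((tendsto_const_nhds.sub (hL2inv.const_mul _)).sqrt).const_mul _
    rw [mul_zero, sub_zero] at hlow
    refine le_of_tendsto_of_tendsto hlow hlim ?_
    filter_upwards [hev_goodφ, hLsφ.eventually_ge_atTop 3] with j hj hj3
    obtain ⟨hampj, -, -⟩ := hΞgood (Ls (φ j)) hj
    simp only [Function.comp_apply] at hj3 ⊢
    have hLpos : (0 : ℝ) < ((Ls (φ j) : ℕ) : ℝ) ^ 2 := by
      have : (3 : ℝ) ≤ (Ls (φ j) : ℕ) := by exact_mod_cast hj3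
      positivity
    rw [torusAvgExpect_localPairAt_zero (Ls (φ j)) g hj3, ← Complex.ofReal_natCast, ← Complex.ofReal_pow,
      Complex.div_ofReal_re]
    rw [le_div_iff₀ hLpos]
    have e : (k : ℝ) / (k + 1) * Real.sqrt (c₀ - (k + 1) * Cγ * ((((Ls (φ j)) : ℕ) : ℝ) ^ 2)⁻¹) *
        (((Ls (φ j) : ℕ) : ℝ)) ^ 2 =
        (k : ℝ) / (k + 1) * ((((Ls (φ j) : ℕ) : ℝ)) ^ 2 *
          Real.sqrt (c₀ - (k + 1) * Cγ / (((Ls (φ j) : ℕ) : ℝ)) ^ 2)) := by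
      rw [div_eq_mul_inv ((k + 1 : ℝ) * Cγ)]; ring
    rw [e]
    exact hampj
  exact ⟨Ξ, φ, ω, μ, hφ, hω, hTI, hρ, hme, hμ, hmin, hgs, hamp⟩

/-! ### §2  The ground-state-complete one-point reading: `liminf u_k ≤ M²` -/

/-- **The ground-state-complete one-point reading (sharp Koma–Tasaki constant).** `U ≥ 0`, `0 < n < 2`.
If `Re ω(Φ₀^g) ≤ M` for every chemical potential `μ ∈ [μ₋(n), μ₊(n)]` and every translation-invariant state `ω`
of density `n` which is a mean-energy minimiser and a Bratteli–Robinson ground state of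
`hubbardTTPrimeMuInteraction t t' U μ`
— the class in which EVERY ground-state row (stationarity; PSD KKT blocks of `H^{tt'} − μN` over arbitrary
generators; all rows of translation-invariant states) is valid — then every family of unit
`(rectN n L, S^z = 0)`-sector ground states of `hubbardTorusTT' L t t' U` has `liminf_k u_k ≤ M²` on the
summit's pair-LRO sequence. [cite: KomaTasaki1994, Theorem 5] [cite: BratteliKishimotoRobinson1978, Thm. 2 (p. 47)] -/
theorem liminf_pairFieldLRO_le_sq_of_groundState_onePoint_bound (t t' : ℝ) {U n : ℝ} (hU : 0 ≤ U)
    (hn0 : 0 < n) (hn2 : n < 2) {M : ℝ}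
    (hM : ∀ μ ∈ Set.Icc (chemPotMinusTT' t t' U n) (chemPotPlusTT' t t' U n), ∀ ω : InfVolFermionState 2,
      ω.IsTranslationInvariant → ω.density = n →
      ω.IsMeanEnergyMinimiser (hubbardTTPrimeMuInteraction t t' U μ) 1 →
      ω.IsGroundState (hubbardTTPrimeMuInteraction t t' U μ) 1 →
        (ω.expect (pairRegion (insert (0 : Site 2) unitSteps) 0)
          (localPairAt (insert (0 : Site 2) unitSteps) g 0)).re ≤ M)
    (ψ : ∀ L, Fock (Orb (FermionTorus 2 L)))
    (hψ : ∀ L, IsGroundStateInSector (hubbardTorusTT' L t t' U) (rectN n L) 0 (ψ L))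
    (hψ1 : ∀ L, star (ψ L) ⬝ᵥ ψ L = 1) :
    liminf (fun k : ℕ => (∑ x ∈ halfOpenBox 2 (2 * k), ∑ y ∈ halfOpenBox 2 (2 * k),
        torusPullback (pairFieldCorr g ψ) (2 * k) x y) / ((#(halfOpenBox 2 (2 * k)) : ℝ)) ^ 2) atTop ≤
      M ^ 2 := by
  set useq : ℕ → ℝ := fun k => (∑ x ∈ halfOpenBox 2 (2 * k), ∑ y ∈ halfOpenBox 2 (2 * k),
      torusPullback (pairFieldCorr g ψ) (2 * k) x y) / ((#(halfOpenBox 2 (2 * k)) : ℝ)) ^ 2 with huseq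
  change liminf useq atTop ≤ M ^ 2
  set vseq : ℕ → ℝ := fun m =>
    (expect ((pairField g (m + 1))ᴴ * pairField g (m + 1)) (ψ (m + 1))).re / (((m + 1 : ℕ) : ℝ)) ^ 4
    with hvseq
  have hterm : ∀ k : ℕ, 1 ≤ k → ∃ m : ℕ, 2 * k = m + 1 ∧ useq k = vseq m := by
    intro k hk
    obtain ⟨m, hm⟩ : ∃ m, 2 * k = m + 1 := ⟨2 * k - 1, by omega⟩
    refine ⟨m, hm, ?_⟩
    simp only [huseq, hvseq]
    rw [hm, torusLROSeq_pairFieldCorr_succ]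
  have hvnonneg : ∀ m : ℕ, 0 ≤ vseq m := fun m => by
    simp only [hvseq]
    refine div_nonneg ?_ (by positivity)
    exact (Complex.nonneg_iff.1
      ((Matrix.posSemidef_conjTranspose_mul_self (pairField g (m + 1))).dotProduct_mulVec_nonneg
        (ψ (m + 1)))).1
  have hnonneg : ∀ k : ℕ, 1 ≤ k → 0 ≤ useq k := fun k hk => by
    obtain ⟨m, -, heq⟩ := hterm k hk
    rw [heq]
    exact hvnonneg m
  have hbdd : IsBoundedUnder (· ≥ ·) atTop useq :=
    isBoundedUnder_of_eventually_ge (a := 0) (Filter.eventually_atTop.2 ⟨1, fun k hk => hnonneg k hk⟩)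
  by_contra hcon
  rw [not_le] at hcon
  obtain ⟨c₀, hc₀M, hc₀lim⟩ := exists_between hcon
  have hc₀ : 0 < c₀ := lt_of_le_of_lt (sq_nonneg M) hc₀M
  have hev : ∀ᶠ k : ℕ in atTop, c₀ < useq k := eventually_lt_of_lt_liminf hc₀lim hbdd
  -- the tower height: `(kt/(kt+1))·√c₀ > M`
  have hsqrt_pos : 0 < Real.sqrt c₀ := Real.sqrt_pos.2 hc₀
  have hMlt : M < Real.sqrt c₀ := by
    have h1 : |M| < Real.sqrt c₀ := by
      rw [← Real.sqrt_sq_eq_abs]; exact Real.sqrt_lt_sqrt (sq_nonneg M) hc₀M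
    exact lt_of_le_of_lt (le_abs_self M) h1
  obtain ⟨kt, hkt⟩ : ∃ kt : ℕ, M < (kt : ℝ) / (kt + 1) * Real.sqrt c₀ := by
    set δ : ℝ := 1 - M / Real.sqrt c₀ with hδ
    have hδpos : 0 < δ := by
      rw [hδ, sub_pos, div_lt_one hsqrt_pos]; exact hMlt
    obtain ⟨kt, hkt⟩ := exists_nat_gt (1 / δ)
    refine ⟨kt, ?_⟩
    have hk1 : (0 : ℝ) < kt + 1 := by positivity
    have h1 : 1 / ((kt : ℝ) + 1) < δ := by
      rw [div_lt_iff₀ hk1]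
      have : 1 / δ * δ = 1 := by field_simp
      nlinarith [hkt, hδpos]
    have h2 : (kt : ℝ) / (kt + 1) = 1 - 1 / (kt + 1) := by field_simp; ring
    rw [h2]
    have h3 : M / Real.sqrt c₀ < 1 - 1 / ((kt : ℝ) + 1) := by rw [hδ] at h1; linarith
    have := (div_lt_iff₀ hsqrt_pos).1 h3
    linarith
  -- the LRO floor along the sides `m + 2` (all sides from `2` on; the even ones carry the sequence)
  -- we use the side sequence `Ls j = 2 * (j + 1)`, written as `(2 * j + 1) + 1`
  set Ls : ℕ → ℕ := fun j => (2 * j + 1) + 1 with hLs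
  haveI hLne : ∀ j, NeZero (Ls j) := fun j => ⟨by simp [hLs]⟩
  have hLs_top : Tendsto Ls atTop atTop := by
    refine tendsto_atTop_mono (fun j => ?_) tendsto_id
    simp only [hLs, id]; omega
  have hlro : ∀ᶠ j in atTop, c₀ * (Ls j : ℝ) ^ 4 ≤
      (expect ((pairField g (Ls j))ᴴ * pairField g (Ls j)) (ψ (Ls j))).re := by
    have hev' : ∀ᶠ j : ℕ in atTop, c₀ < useq (j + 1) := (tendsto_add_atTop_nat 1).eventually hev
    filter_upwards [hev'] with j hj
    obtain ⟨m, hm, heq⟩ := hterm (j + 1) (by omega)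
    have hmj : m = 2 * j + 1 := by omega
    rw [heq] at hj
    simp only [hvseq] at hj
    have h := hj.le
    rw [le_div_iff₀ (by positivity)] at h
    subst hmj
    exact h
  obtain ⟨Ξ, φ, ω, μc, -, -, hTI, hρ, -, hμc, hmin, hgs, hamp⟩ :=
    exists_torusLimit_towerWitness_groundState g t t' hU hn0 hn2 ψ hψ hψ1 hLs_top hc₀ hlro kt
  have hle := hM μc hμc ω hTI hρ hmin hgs
  linarith

/-- **Registry consumer.** At an anchor `(U, n, t')` of the `t–t'` model at `t = 1` (`U ≥ 0`, `0 < n < 2`),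
form factor `g_d`: a ONE-POINT bound `Re ω(Φ₀^d) ≤ M` valid for every translation-invariant ground state
(= minimiser and Bratteli–Robinson ground state of `hubbardTTPrimeMuInteraction 1 tp U μ`, `μ` in the
subdifferential `[μ₋(n), μ₊(n)]`) of density `n` — in particular a certificate using ANY ground-state rows with
one common `μ`, covered over a certified bracket `⊇ [μ₋(n), μ₊(n)]` — gives the
summit-format leaf `ObsPairLROCeilingAt tp U n c'` for every rational `c' ≥ M²`.
[cite: KomaTasaki1994, Theorem 5] -/
theorem ObsPairLROCeilingAt_of_groundState_onePoint_bound {tp U n : ℝ} (hU : 0 ≤ U) (hn0 : 0 < n)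
    (hn2 : n < 2) {M : ℝ} {c' : ℚ}
    (hM : ∀ μ ∈ Set.Icc (chemPotMinusTT' 1 tp U n) (chemPotPlusTT' 1 tp U n), ∀ ω : InfVolFermionState 2,
      ω.IsTranslationInvariant → ω.density = n →
      ω.IsMeanEnergyMinimiser (hubbardTTPrimeMuInteraction 1 tp U μ) 1 →
      ω.IsGroundState (hubbardTTPrimeMuInteraction 1 tp U μ) 1 →
        (ω.expect (pairRegion (insert (0 : Site 2) unitSteps) 0)
          (localPairAt (insert (0 : Site 2) unitSteps) dWaveFormFactor 0)).re ≤ M)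
    (hc' : M ^ 2 ≤ (c' : ℝ)) :
    ObsPairLROCeilingAt tp U n c' := by
  intro ψ hψ hψ1
  exact (liminf_pairFieldLRO_le_sq_of_groundState_onePoint_bound dWaveFormFactor 1 tp hU hn0 hn2 hM ψ hψ
    hψ1).trans hc'

end Family

end Summit.Ventures.CertifiedManyBodySolver.Observables

end
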